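import Summits.QuantumFields.YangMills.Theorems.F4SubCurvatureDoorShortRootRigidityTwoReflections
import Summits.QuantumFields.YangMills.Theorems.F4SubCurvatureDoorShortRootRigiditySchwarzReflection
import Summits.QuantumFields.YangMills.Theorems.F4SubCurvatureDoorShortRootRigiditySectoralHarmonic
import Mathlib
import HarnessLib

/-!
# TRIGONAL INJECTIVITY (P_s), trace form — the algebraic core of `stub_oddModeRigidity` (crux ⟨stmt-QuantumFields-23035⟩
# `F4SubCurvatureDoor.ShortRootRigidity`, LINE g21-C :146), kernel-checked after the owner's paper proof
# `Cruxes/ShortRootRigidity/TrigonalInjectivity.md` v4 §1-bis (ym-idea-3 g21; critic idea-crit-4 g10 PASS)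

THEOREM (`eq_zero_of_trace`, for every `s ≥ 1`): let `Y ∈ ℝ[x₀,x₁,x₂]` be harmonic (`laplacian3 Y = 0`), invariant under the two coordinate
sign flips `x₁ ↦ −x₁`, `x₂ ↦ −x₂` (as functions), and suppose its trace on the plane `x₀ + x₁ + x₂ = 0` is a multiple of the sectoral harmonic:
`Y(x) = a · E_s(x)` whenever `x₀ + x₁ + x₂ = 0` (`E_s = …SectoralHarmonic.sect s = Re (ℓ·x)^{6s}`, so on the plane `Y(u,v,−u−v) = a R_s(u,v)`,
`R_s(u,v) = Re(u − ζv)^{6s}` — the hypothesis of `TrigonalInjectivity s` in the rational form of §1-bis).  THEN `Y = 0`.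
No homogeneity and no permutation invariance are needed; `s ≥ 1` is needed (`s = 0`: `Y = 1`).

PROOF = §1-bis assembled from the landed bricks: (2′) `u = Y − aE_s` is harmonic and vanishes on the plane ⇒ Schwarz reflection
(✓`…SchwarzReflection.eval_reflect_eq_neg`) and `E_s∘σ₁ = E_s` (✓`eval_sect_reflect`) give `(R_{d₀}) Y(σ₁x) + Y(x) = 2aE_s(x)`; conjugating by the
sign flips gives `(R_{d′})`, `(R_{d″})` for `d′ = (1,1,−1)`, `d″ = (1,−1,1)` with `E_{d′} = E_s∘flip₂`, `E_{d″} = E_s∘flip₁`; (3′)(4′) at the MAGIC POINT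
`P = (2,1,3) ∈ Π_{d′}` (fixed by `σ_{d′}`) and `Q = σ₁P = (−2,−3,−1) ∈ Π_{d″}`: `Y(P) = aE_s(2,1,−3) = aA_s`, `Y(Q) = aE_s(−2,3,−1) = aA_s`
(✓`eval_sect_P'`, ✓`eval_sect_Q''`), and `(R_{d₀})` at `P` with ✓`eval_sect_P : E_s(P) = 1` gives `a(A_s − 1) = 0`; (6) `A_s = (piPow (6s)).1 ≡ 4 (mod 7)`
(`piPow_six_mul_fst_ne_one`, the owner's `TrigonalArithmetic` argument re-run for `piPow` — a Theorems file cannot import the Cruxes anchor) ⇒ `a = 0`;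
(7′) then `Y∘σ₁ = −Y`, `Y∘σ₂ = −Y` and ✓`…TwoReflections.eq_zero_of_odd_under_two_diagonal_reflections` gives `Y = 0`.

WHAT THIS IS / IS NOT: it is (P_s) of the note in the trace form (§1-bis hypothesis), for all `s ≥ 1`, as a tree theorem over explicit polynomials.
It is NOT yet `stub_oddModeRigidity`: the typed `TrigonalInjectivity s` / `NoBadModes L` (g75, R-O1) must be bridged to this hypothesis (weights ⇒
trace: even degree kills odd planar frequencies, `(u·L)²`-eigenfunctions restrict to `∂_φ²`-eigenfunctions), and §2 (torus reduction) + R-O1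
(analytic half) remain.  HONEST LABEL: ⟨23035⟩, ⟨23125⟩, R2d and the Yang–Mills mass gap remain OPEN; no summit is proved by a line.
-/

noncomputable section

namespace Summit.QuantumFields.YangMills.Theorems.F4SubCurvatureDoorTrigonalInjectivityCore

open MvPolynomial
open Summit.QuantumFields.YangMills.Theorems.F4SubCurvatureDoorTwoReflections (σ₁ σ₂ eq_zero_of_odd_under_two_diagonal_reflections)
open Summit.QuantumFields.YangMills.Theorems.F4SubCurvatureDoorSchwarzReflection (laplacian3 eval_reflect_eq_neg)
open Summit.QuantumFields.YangMills.Theorems.F4SubCurvatureDoorSectoralHarmonic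
  (sect laplacian3_sect eval_sect_reflect eval_sect_P eval_sect_P' eval_sect_Q'' piPow)


/-! ### arithmetic: `a_{6s} ≠ 1` (the owner's ZMod 7 argument, for `piPow`) -/

/-- The recurrence `(2+√−3)^n` read in `ZMod 7` (as in the owner's `TrigonalArithmetic.lean`). -/
def piPowMod : ℕ → ZMod 7 × ZMod 7
  | 0 => (1, 0)
  | n + 1 => (2 * (piPowMod n).1 - 3 * (piPowMod n).2, (piPowMod n).1 + 2 * (piPowMod n).2)

/-- `piPowMod n` is the reduction of `piPow n`. -/
theorem piPowMod_eq_cast (n : ℕ) :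
    piPowMod n = ((((piPow n).1 : ℤ) : ZMod 7), (((piPow n).2 : ℤ) : ZMod 7)) := by
  induction n with
  | zero => rfl
  | succ k ih =>
      show (2 * (piPowMod k).1 - 3 * (piPowMod k).2, (piPowMod k).1 + 2 * (piPowMod k).2)
        = ((((2 * (piPow k).1 - 3 * (piPow k).2 : ℤ)) : ZMod 7),
            (((piPow k).1 + 2 * (piPow k).2 : ℤ) : ZMod 7))
      rw [ih]
      ext <;> push_cast <;> ring

/-- Period `3` from index `1` on. -/
theorem piPowMod_periodic (k : ℕ) : piPowMod (k + 4) = piPowMod (k + 1) := by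
  induction k with
  | zero => decide
  | succ k ih =>
      show (2 * (piPowMod (k + 4)).1 - 3 * (piPowMod (k + 4)).2, (piPowMod (k + 4)).1 + 2 * (piPowMod (k + 4)).2)
        = (2 * (piPowMod (k + 1)).1 - 3 * (piPowMod (k + 1)).2, (piPowMod (k + 1)).1 + 2 * (piPowMod (k + 1)).2)
      rw [ih]

/-- Periodicity, iterated. -/
theorem piPowMod_add_three_mul (k m : ℕ) : piPowMod (k + 1 + 3 * m) = piPowMod (k + 1) := by
  induction m with
  | zero => simp
  | succ m ih =>
      have h : k + 1 + 3 * (m + 1) = (k + 3 * m) + 4 := by ring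
      rw [h, piPowMod_periodic, show k + 3 * m + 1 = k + 1 + 3 * m by ring, ih]

/-- `(A_s, B_s) ≡ (4, 2) (mod 7)` for `s ≥ 1`. -/
theorem piPowMod_six_mul (s : ℕ) (hs : 1 ≤ s) : piPowMod (6 * s) = (4, 2) := by
  obtain ⟨t, rfl⟩ := Nat.exists_eq_add_of_le hs
  have h : 6 * (1 + t) = 2 + 1 + 3 * (2 * t + 1) := by ring
  rw [h, piPowMod_add_three_mul]
  decide

/-- **`A_s ≠ 1`** for `s ≥ 1` (the arithmetic core, owner's step (6)). -/
theorem piPow_six_mul_fst_ne_one (s : ℕ) (hs : 1 ≤ s) : (piPow (6 * s)).1 ≠ 1 := by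
  intro h1
  have hmod := piPowMod_six_mul s hs
  rw [piPowMod_eq_cast, h1] at hmod
  have h4 : ((1 : ℤ) : ZMod 7) = 4 := (Prod.mk.inj hmod).1
  revert h4
  decide

/-! ### the assembly -/

/-- The coordinate sign flip `x₁ ↦ −x₁`. -/
def flip1 (x : Fin 3 → ℝ) : Fin 3 → ℝ := fun j => if j = 1 then -x j else x j
/-- The coordinate sign flip `x₂ ↦ −x₂`. -/
def flip2 (x : Fin 3 → ℝ) : Fin 3 → ℝ := fun j => if j = 2 then -x j else x j

/-- **TRIGONAL INJECTIVITY (P_s), trace form (§1-bis), all `s ≥ 1`.** [owner's note `Cruxes/ShortRootRigidity/TrigonalInjectivity.md` v4; folklore ingredients] -/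
theorem eq_zero_of_trace (s : ℕ) (hs : 1 ≤ s) (Y : MvPolynomial (Fin 3) ℝ) (hharm : laplacian3 Y = 0)
    (hflip1 : ∀ x, eval (flip1 x) Y = eval x Y) (hflip2 : ∀ x, eval (flip2 x) Y = eval x Y)
    (a : ℝ) (htrace : ∀ x : Fin 3 → ℝ, x 0 + x 1 + x 2 = 0 → eval x Y = a * eval x (sect s)) : Y = 0 := by
  set E := sect s with hE
  -- (2′) Schwarz reflection for `u = Y − aE`
  have hu_harm : laplacian3 (Y - C a * E) = 0 := by
    have h1 : laplacian3 E = 0 := laplacian3_sect s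
    simp only [laplacian3, map_sub, pderiv_C_mul, Finset.sum_sub_distrib, ← Finset.mul_sum] at hharm h1 ⊢
    rw [hharm, h1, mul_zero, sub_zero]
  have hu_van : ∀ x : Fin 3 → ℝ, x 0 + x 1 + x 2 = 0 → eval x (Y - C a * E) = 0 := by
    intro x hx
    rw [map_sub, map_mul, eval_C, htrace x hx, sub_self]
  have hR0 : ∀ x : Fin 3 → ℝ, eval (σ₁ x) Y + eval x Y = 2 * a * eval x E := by
    intro x
    have h := eval_reflect_eq_neg (Y - C a * E) hu_harm hu_van x
    simp only [map_sub, map_mul, eval_C] at h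
    have hEσ : eval (fun i => x i - 2 / 3 * (x 0 + x 1 + x 2)) E = eval x E := eval_sect_reflect x s
    rw [hEσ] at h
    have : σ₁ x = fun i => x i - 2 / 3 * (x 0 + x 1 + x 2) := rfl
    rw [this]
    linarith
  -- (R_{d′}) for d′ = (1,1,−1) by conjugating with flip2
  have hσ₂ : ∀ x : Fin 3 → ℝ, σ₂ x = flip2 (σ₁ (flip2 x)) := by
    intro x; funext i; fin_cases i <;> simp [σ₁, σ₂, flip2] <;> ring
  have hR2 : ∀ x : Fin 3 → ℝ, eval (σ₂ x) Y + eval x Y = 2 * a * eval (flip2 x) E := by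
    intro x
    rw [hσ₂, hflip2, ← hflip2 x]
    have hff : flip2 (flip2 x) = x := by funext i; simp [flip2]; split_ifs <;> simp
    have h := hR0 (flip2 x)
    exact h
  -- (R_{d″}) for d″ = (1,−1,1) by conjugating with flip1
  set σ₃ : (Fin 3 → ℝ) → (Fin 3 → ℝ) := fun x => flip1 (σ₁ (flip1 x)) with hσ₃
  have hR3 : ∀ x : Fin 3 → ℝ, eval (σ₃ x) Y + eval x Y = 2 * a * eval (flip1 x) E := by
    intro x
    rw [hσ₃]
    dsimp only
    rw [hflip1, ← hflip1 x]
    exact hR0 (flip1 x)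
  -- the magic point
  have hP2 : σ₂ ![2, 1, 3] = ![2, 1, 3] := by funext i; fin_cases i <;> simp [σ₂] <;> norm_num
  have hQ3 : σ₃ ![-2, -3, -1] = ![-2, -3, -1] := by rw [hσ₃]; funext i; fin_cases i <;> simp [σ₁, flip1] <;> norm_num
  have hQ : σ₁ ![(2 : ℝ), 1, 3] = ![-2, -3, -1] := by funext i; fin_cases i <;> simp [σ₁] <;> norm_num
  have hfP : flip2 ![(2 : ℝ), 1, 3] = ![2, 1, -3] := by funext i; fin_cases i <;> simp [flip2]
  have hfQ : flip1 ![(-2 : ℝ), -3, -1] = ![-2, 3, -1] := by funext i; fin_cases i <;> simp [flip1]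
  have hYP : eval ![(2 : ℝ), 1, 3] Y = a * (piPow (6 * s)).1 := by
    have h := hR2 ![2, 1, 3]
    rw [hP2, hfP, hE, eval_sect_P'] at h
    linarith
  have hYQ : eval ![(-2 : ℝ), -3, -1] Y = a * (piPow (6 * s)).1 := by
    have h := hR3 ![-2, -3, -1]
    rw [hQ3, hfQ, hE, eval_sect_Q''] at h
    linarith
  have hstar : a * (((piPow (6 * s)).1 : ℝ) - 1) = 0 := by
    have h := hR0 ![2, 1, 3]
    rw [hQ, hYP, hYQ, hE, eval_sect_P] at h
    linarith
  have ha : a = 0 := by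
    rcases mul_eq_zero.mp hstar with h | h
    · exact h
    · exfalso
      have : ((piPow (6 * s)).1 : ℝ) = 1 := by linarith
      exact piPow_six_mul_fst_ne_one s hs (by exact_mod_cast this)
  -- a = 0: Y odd under σ₁ and σ₂ ⇒ Y = 0
  refine eq_zero_of_odd_under_two_diagonal_reflections Y (fun x => ?_) (fun x => ?_)
  · have h := hR0 x; rw [ha] at h; linarith
  · have h := hR2 x; rw [ha] at h; linarith

end Summit.QuantumFields.YangMills.Theorems.F4SubCurvatureDoorTrigonalInjectivityCore

end
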